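import Literature.MathematicalPhysics.QuantumFieldTheory.Balaban1983to89.B6RandomWalkL2ChainWith
import Literature.MathematicalPhysics.QuantumFieldTheory.Balaban1983to89.B6RandomWalkL2Schur
import Literature.MathematicalPhysics.QuantumFieldTheory.Balaban1983to89.B6RandomWalkL2Grad2LegV1
import Literature.MathematicalPhysics.QuantumFieldTheory.Balaban1983to89.B6Prop26KLevelSkeletonV2
import Literature.MathematicalPhysics.QuantumFieldTheory.Balaban1983to89.B6Ineq2134KFamKLevelExportV1
import Literature.MathematicalPhysics.QuantumFieldTheory.Balaban1983to89.B6Ineq2140GradKLevelCensusV1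

/-!
# `Balaban1983to89.B6RandomWalkL2Prop26Grad2KLevelV1` — T. Bałaban, *Propagators and renormalization transformations for lattice gauge theories. II*,
# Commun. Math. Phys. **96** (1984) 223–250 [Balaban1984PropagatorsII], Prop. 2.6, THE FIFTH `L²` ENTRY `‖ζ∇∇GJ‖ ≤ O(1)|ζ|e^{−δ₃d(y,y′)}‖J‖` OF (2.140)
# p. 247 AT k LEVELS FOR THE GENUINE `G = Δ_a⁻¹` ON THE V1 TORUS — THE `L²` WALK (2.141) ASSEMBLED: from the landed per-cube `ℓ²` first legs
# `∇_ν∇_μ(h_□G_□h_□)` and the (2.91) identity of the genuine cube family, GIVEN the (2.134) sup bounds of the pair terms `K_{□,□′}G_{□′}h_{□′}` and of their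
# transposes (file 11 of the block-`ℓ²` bricks of `…B6RandomWalkL2`; census slot hl4 of r03's `B6Prop26Census2140KLevelV1` up to those two displayed families)

statement-level skeleton of published theorems with citation tags; proofs where landed; nothing here is a claim about the Yang–Mills mass gap

WHAT IS PRINTED (p. 247 [PDF 25], render `inprint/lit-balaban-p05/renders/cmp96/p25.png`): *"‖ζGJ‖, ‖ζ∇GJ‖, ‖ζG∇*J‖, ‖ζ∇G∇*J‖, ‖ζ∇∇GJ‖, ‖ζG∇*∇*J‖ ≤
O(1)[(Lʲη)², Lʲη, Lʲη, 1, 1, 1]|ζ|e^{−δ₃d(y,y′)}‖J‖ (2.140) if supp ζ ⊂ Δ(y), y ∈ Λ_j, supp J ⊂ Δ(y′) … |(K_{□,□′}G_{□′}h_{□′}J)(x)| ≤ O(M⁻¹)e^{−½δ₂d(y,y′)}|J|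
(2.134) … The operator G can be represented as G = G₀(I − R)⁻¹ = Σ_{n=0}^∞ G₀Rⁿ = … (2.141) and the series above is convergent in the norms appearing in the
inequalities (2.136)–(2.140)."*; p. 239 [PDF 17]: *"G₀ = Σ_{□∈𝒟} h_□G_□h_□ (2.90) … Δ_aG₀ = I − Σ K_{□,□′}G_{□′}h_{□′} = I − R (2.91)"*.

CITATION HEADER (lean-in-tree rule) — WHAT IS REPRODUCED.  Phase-2 file of the `lit-balaban` typed skeleton (HOME `run/shared/lean/pub/lit-balaban/`), seat
**p22 gen 30** (free-target protocol G.5-34(d), TAKING HOME/STATUS 2026-08-24T13:26Z «block-ℓ² walk toward census (2.140)₄₋₆», cc r03/p38); SKELETON rows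
**B6.Prop2.6** × B6.Eq2.141 × B6.Eq2.134 × B6.Eq2.91 (cells only; decls of record untouched).  THE `L²` ENTRY (2.140)₅ HAS NO SUP MAJORANT (the kernel of
`∇∇G` is Calderón–Zygmund); print's route is the walk (2.141) summed *"in the norms appearing in (2.140)"*.  This file assembles it for the GENUINE k-level
family of cubes of r03/p38's ROUTE V (`Gl`, `Ml`, `Pl`, `hB`, `zB` of `…B6CubeWindowV1` / `…B6Prop26KLevelSkeletonV1`, the torus `geomT D`, fine bonds `blkV1`):
* §1 `ind_ST_le_ind_SbigT`, kernel bookkeeping (the transpose relation `(tr T)δ_x(x′) = Tδ_{x′}(x)` the Schur bridge consumes is this seat's landed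
  `…B6Ineq2140GradKLevelCensusV1.tr_single_apply`, the symmetry of `d_T` is `…B8Ineq192MultiLevelTorus.symmT` — both BY NAME);
* §2 **`prop26_2140_grad2_kLevel_skeleton`** — for the weight band `[b₀, b₁]` there are `ρ_D > 0`, `C_D ≥ 0` (the rate and constant of the landed `ℓ²` first
  leg `…B6RandomWalkL2Grad2LegV1.hDDG0_l2_cube`) such that on every admissible V1 torus (`k ≥ 2`, `M_h = L^a ≥ 8`, `R ≥ 2L²`, `P′ ≥ 5`, `L ≥ 5`, cubes
  placed, global band), for every rate `0 < σ ≤ ρ_D`, Lemma-2.1 budget `(α, N₀)` with its (2.59)-threshold, overlap number `Nbig` of the `□̃`, and GIVEN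
  (displayed, printed shapes): `OutLoc (M_□h_□) □̃` (p38), **the (2.134) sup majorant `θ₀e^{−σd_T}` of every `K_{□,□′}G_{□′}h_{□′}`** of the genuine (2.91)
  family (`kFam (∂(1−R)∂*) h ζ M P □ □′ · G_□′ · h_□′`, EXACTLY the input `h2134` of r03's `…B6Prop26KLevelSkeletonV2.prop26_2136_kLevel_skeleton₂`, which
  r03's `…B6Prop26KLevelAssemblyV1` discharges inside its proof from p38's `inputs2134_kFam_torus_in`) **and of its transpose `tr (…)`** (p38's reversed family,
  `…B6Ineq2134TransposeKLevelTorus.h2134T_kFamT_torus` through `…B6OpTransposeV1`), and the located smallness `Nbig²θ₀·K261 < 1`: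
  `HasL2Majorant (geomT D) (blkV1 hN D) (∇_ν∇_μG) ((Nbig·C_D)·K261·(1 − Nbig²θ₀K261)⁻¹·e^{−(1−α)σ·d_T(y,y′)})` — print's (2.140)₅ with its prefactor `1`.
  PROVED INSIDE (by name): the `G₀`-legs in `ℓ²` for every cube (`hDDG0_l2_cube`, p22 g29); (2.91) `Δ_aG₀ = I − R` for the genuine family (`eq291` with
  `hagree_cube`, `hinvl_cube`, `sum_mulOp_hB_sq`, `mulOp_zB_mul_hB`, `mulOp_hB_mul_zB`) and `GΔ_a = 1` (`onFun_GE_mul_deltaAE`) ⟹ `G = G₀ + GR` ⟹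
  `∇∇G = ∇∇G₀ + (∇∇G)R`; the `ℓ²` bound of every pair product from the two displayed sup bounds (`…B6RandomWalkL2Schur.hasL2Majorant_exp_of_hasMajorant_pair`,
  `d_T` symmetric); the output localisation of `K_{□,□′}G_{□′}` over `□̃` (`outLoc_kFam_big`); Lemma 2.1 on the torus (`lemma21_torus`, constant `K261`);
  the gluing and the chain (`…B6RandomWalkL2ChainWith.prop26_2140_of_l2legsWith`);
* §3 **`prop26_2140_grad2_kLevel_sigma`** — the same in the census Σ-shape `Σ_x(ζ(x)(∇_ν∇_μGJ)(x))² ≤ (A·e^{−δd_T}·s)²Σ_xJ(x)²` for `supp ζ ⊂ Δ(y)`, `|ζ| ≤ s`,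
  `supp J ⊂ Δ(y′)` (`…B6RandomWalkL2.sum_sq_cut_apply_le_of_hasL2Majorant`), and **`prop26_2140_grad2T_kLevel_skeleton`** — the transposed entry
  `tr (∇_ν∇_μG)` (= `G∇*_μ∇*_ν`, the sixth column) with the same majorant (`hasL2Majorant_tr`, `d_T` symmetric);
* §4 **`prop26_2140_grad2_kLevel_of_2134T`** — the same with the direct family FED by this seat's `…B6Ineq2134KFamKLevelExportV1.h2134_kFam_kLevel_unconditional`
  (no displayed analytic input), `OutLoc (M_□h_□) □̃` by p38's `…B6CubeMoutV1.outLoc_Ml_hB'`, `Nbig = 3·9^{d+1}` by r03's `card_filter_mem_QbigT_le` and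
  `(1 − Nbig²θK261)⁻¹ ≤ 2`: ONLY the transposed family `tr (K_{□,□′}G_{□′}h_{□′})` and its smallness stay displayed; constant `2·Nbig·C_D·K261`.
THEOREMS ONLY (no definition, no `def … : Prop`); the displayed inputs are hypotheses of the printed shapes (2.134)/(2.134)ᵀ; IMPORTS BY NAME; standard axioms.

HONEST SCOPE / DIVERGENCES.  (1) In §2 TWO per-pair inputs are displayed (the (2.134) sup majorants of `K_{□,□′}G_{□′}h_{□′}` and of its transpose at the rate
`σ`) plus `OutLoc (M_□h_□) □̃` and the overlap number; in §4 only the TRANSPOSED family (with its smallness) remains — it is what p38's mirror files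
(`B6Ineq2134TransposeKLevelTorus.h2134T_kFamT_torus`, `B6Prop26MirrorAssemblyV1`, in flight) produce inside their proofs, read through `B6OpTransposeV1`
(`tr_mul`, `tr_Gl`, `tr_Ml`, `tr_Pl`, `tr_mulOp`); exporting it as a named per-pair theorem closes (2.140)₅,₆ at k levels hypothesis-free.  (2) `L ≥ 5`,
`M_h = L^a ≥ 8`, `R ≥ 2L²`, `P′ ≥ 5`, `k ≥ 2`, cubes placed, global band — as ROUTE V.  (3) Lemma 2.1 with the torus constant `K261 N₀ (d+1) L 1 (ασ)` (the
printed `c₁` is refuted as printed, GAPS G-A11-1); `δ₃ = (1 − α)σ`.  (4) Unweighted `ℓ²` on the fine bonds, lattice units; the entry `∇G∇*` ((2.140)₄) is NOT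
reachable this way (GAPS G-B6-2140-456).  Nothing on d = 4 or the continuum; NOT summit progress.  Unit `lit-balaban-p22` (gen 30), 2026-08-24.
-/

noncomputable section

open scoped BigOperators
open Finset

namespace Literature.MathematicalPhysics.QuantumFieldTheory.Balaban1983to89.B6RandomWalkL2Prop26Grad2KLevelV1

open LatticeFieldCalculus
open B6MultiLevelBoxOperator (N0)
open B6MultiLevelTorusOperator (TDomains)
open B6Cover236MultiLevelBlocks (cubes)
open B6Geom246MultiLevelTorus (geomT lemma21_torus triangle_refl_nonneg_T)
open B6RandomWalk (HasMajorant hasMajorant_mono delta3 Triangle254)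
open B6RandomWalkL2 (l2n HasL2Majorant hasL2Majorant_mono sum_sq_cut_apply_le_of_hasL2Majorant)
open B6RandomWalkL2Schur (hasL2Majorant_exp_of_hasMajorant_pair hasL2Majorant_tr)
open B6RandomWalkL2ChainWith (prop26_2140_of_l2legsWith)
open B6RandomWalkL2Grad2LegV1 (hDDG0_l2_cube)
open B6Prop26Gluing (mulOp mulOp_apply OutLoc ind ind_nonneg ind_le_one ind_of_mem ind_of_not_mem)
open B6Prop26 (fixedPoint_of_291)
open B6Ineq261LevelGap (K261 K261_nonneg)
open B6Lemma21Repaired (Ineq261With Ineq263With)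
open B6Eq291Generator (kFam gZero rOp eq291)
open B6OpTransposeV1 (tr tr_apply_single)
open B6Ineq2133TwoScaleV1 (onFun)
open B8Ineq192MultiLevelTorus (symmT)
open B6Ineq2140GradKLevelCensusV1 (tr_single_apply)
open B6GlobalChartV1 (PV toBox domT blkV1)
open B6AgreeLapV1Chart (deltaAE_split)
open B6SectAOperatorsV1 (dE dsE dcE dcsE QE aE QsE RE BondIdx)
open B6SectAVectorModelV1 (GE deltaAE)
open B6GradLegKLevelV1 (DV)
open B6Partition118KLevelTorusCentral (QT QbigT one_le_of_four_le)
open B6Prop26KLevelSkeletonV1 (hB zB ST mem_ST abs_hB_le_one blkV1_mem_QT_of_hB_ne_zero mulOp_zB_mul_hB mulOp_hB_mul_zB sum_mulOp_hB_sq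
  onFun_GE_mul_deltaAE)
open B6Prop26KLevelSkeletonV2 (SbigT mem_SbigT ST_subset_SbigT hNov_SbigT_of_QbigT blkV1_mem_SbigT_of_hB_ne_zero outLoc_kFam_big)
open B6CubeWindowV1 (Placed Gl Ml Pl GlobalBand hagree_cube hinvl_cube band_of_global band_le one_le_of_eight_le four_le_of_five_le)
open B6Ineq2134KFamKLevelExportV1 (h2134_kFam_kLevel_unconditional)
open B6Prop26KLevelAssemblyV1 (small_of_small_two final_const_le)
open B6CubeMoutV1 (outLoc_Ml_hB')
open B6Cover236QbigOverlapV1 (card_filter_mem_QbigT_le)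

variable {d ℓ : ℕ} {hd : 1 ≤ d + 1} {hL : Odd (ℓ + 1) ∧ 1 < ℓ + 1} {m K : ℕ} {Mh k R : ℕ} {P' : Fin (d + 1) → ℕ}

/-! ## §1  Small bookkeeping -/

section Small

/-- rate weakening of an exponential kernel. [folklore] -/
private theorem exp_le_exp_of_rate {ρ σ t : ℝ} (h : σ ≤ ρ) (ht : 0 ≤ t) : Real.exp (-(ρ * t)) ≤ Real.exp (-(σ * t)) :=
  Real.exp_le_exp.mpr (neg_le_neg (mul_le_mul_of_nonneg_right h ht))

variable {D : TDomains d ℓ Mh k P' R}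

open Classical in
/-- `1_{□⁺} ≤ 1_{□̃}` (`□⁺ ⊆ □̃`). [cite: Balaban1984PropagatorsII, p.235, p.239, bookkeeping] -/
theorem ind_ST_le_ind_SbigT (hMh1 : 1 ≤ Mh) (hP4 : ∀ μ, 4 ≤ P' μ) (c : ↥(cubes D.toDomains)) (y : (geomT D).Site) :
    ind (ST D hMh1 hP4 c) y ≤ ind (SbigT D hMh1 hP4 c) y := by
  by_cases hy : y ∈ ST D hMh1 hP4 c
  · rw [ind_of_mem hy, ind_of_mem (ST_subset_SbigT D hMh1 hP4 c hy)]
  · rw [ind_of_not_mem hy]; exact ind_nonneg _ _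

end Small

/-! ## §2  (2.140)₅ at k levels for the genuine `G`: the `L²` walk assembled -/

section Skeleton

set_option maxHeartbeats 1600000 in
open Classical in
/-- **PROPOSITION 2.6, THE `L²` ENTRY `‖ζ∇_ν∇_μGJ‖` OF (2.140), FOR THE GENUINE k-LEVEL `G = Δ_a⁻¹` ON THE V1 TORUS — THE `L²` WALK (2.141) ASSEMBLED**
from the landed per-cube `ℓ²` first legs and the (2.91) identity of the genuine cube family, GIVEN the (2.134) sup majorants of the pair products
`K_{□,□′}G_{□′}h_{□′}` and of their transposes at the rate `σ`, the output localisation `OutLoc (M_□h_□) □̃`, the overlap number `Nbig` of the `□̃` and the located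
smallness `Nbig²θ₀·K261 < 1`: `HasL2Majorant (∇_ν∇_μG) ((Nbig·C_D)·K261·(1 − Nbig²θ₀K261)⁻¹·e^{−(1−α)σ d_T})` — (2.140)₅ with print's prefactor `1`.
[cite: Balaban1984PropagatorsII, Prop. 2.6 (2.140)–(2.141) p.247, (2.133)–(2.135) p.247, (2.90)–(2.91) p.239, Lemma 2.1 p.234] -/
theorem prop26_2140_grad2_kLevel_skeleton (d ℓ : ℕ) (hd : 1 ≤ d + 1) (hL : Odd (ℓ + 1) ∧ 1 < ℓ + 1) {b₀ b₁ : ℝ} (hb₀ : 0 < b₀) (hb₁ : b₀ ≤ b₁) :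
    ∃ ρD : ℝ, 0 < ρD ∧ ∃ CD : ℝ, 0 ≤ CD ∧
    ∀ (m K : ℕ) {Mh k R : ℕ} {P' : Fin (d + 1) → ℕ}
      (hN : ∀ μ, N0 ℓ Mh k P' μ = (PV d ℓ m K hd hL).sitesPerDir 0) (D : TDomains d ℓ Mh k P' R) (hk : k ≤ m + K) (_ : 2 ≤ k)
      {a : ℕ} (hMha : Mh = (ℓ + 1) ^ a) (hM8 : 8 ≤ Mh) (_ : 2 * (ℓ + 1) ^ 2 ≤ R) (hP5 : ∀ μ, 5 ≤ P' μ) (_ : 4 ≤ ℓ)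
      (hpl : ∀ c : ↥(cubes D.toDomains), Placed ℓ k P' c.1)
      {cf : ℝ} (hcf : cf ≠ 0) {w : BondIdx (domT hN D hk) → ℝ} (hw : ∀ i, 0 < w i) (_ : GlobalBand b₀ b₁ cf w)
      -- the rate and the Lemma-2.1 budget
      {σ : ℝ} (_ : 0 < σ) (_ : σ ≤ ρD) (α : ℝ) (_ : 0 ≤ α) (_ : α ≤ 1) (N₀ : ℕ) (_ : 0 < N₀) (_ : N₀ + 1 ≤ R * ((ℓ + 1) * Mh))
      (_ : Real.exp (-(α * σ)) * ((ℓ : ℝ) + 1) ^ ((2 * (d + 1 : ℕ) : ℝ) / N₀) < 1)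
      -- the overlap count of the `□̃`
      (Nbig : ℕ) (_ : ∀ y : (geomT D).Site, (Finset.univ.filter fun c : ↥(cubes D.toDomains) =>
        y ∈ QbigT D (one_le_of_eight_le hM8) (four_le_of_five_le hP5) c).card ≤ Nbig)
      -- the output localisation of `M_□h_□`
      (_ : ∀ c : ↥(cubes D.toDomains), OutLoc (g := geomT D) (blkV1 hN D)
        (Ml hN hk (one_le_of_eight_le hM8) (four_le_of_five_le hP5) hMha c (band_le (d := d) (ℓ := ℓ) hb₀ hb₁) (hpl c) w cf * mulOp (hB hN D c))
        (SbigT D (one_le_of_eight_le hM8) (four_le_of_five_le hP5) c))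
      -- the displayed (2.134) sup families: the pair products and their transposes, rate `σ`
      (θ₀ : ℝ) (_ : 0 ≤ θ₀)
      (_ : ∀ c c' : ↥(cubes D.toDomains), HasMajorant (g := geomT D) (blkV1 hN D)
        ((kFam (onFun (dE (P := PV d ℓ m K hd hL) cf ∘ₗ (LinearMap.id - RE (domT hN D hk) cf) ∘ₗ dsE cf))
            (fun c => mulOp (hB hN D c)) (fun c => mulOp (zB hN D (one_le_of_eight_le hM8) (four_le_of_five_le hP5) c))
            (fun c => Ml hN hk (one_le_of_eight_le hM8) (four_le_of_five_le hP5) hMha c (band_le (d := d) (ℓ := ℓ) hb₀ hb₁) (hpl c) w cf)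
            (fun c => Pl hN hk (one_le_of_eight_le hM8) (four_le_of_five_le hP5) hMha c (band_le (d := d) (ℓ := ℓ) hb₀ hb₁) (hpl c) w cf) c c' *
          Gl hN hk (one_le_of_eight_le hM8) (four_le_of_five_le hP5) hMha c' (band_le (d := d) (ℓ := ℓ) hb₀ hb₁) (hpl c') w cf) * mulOp (hB hN D c'))
        (fun y y' => θ₀ * Real.exp (-(σ * (geomT D).dist y y'))))
      (_ : ∀ c c' : ↥(cubes D.toDomains), HasMajorant (g := geomT D) (blkV1 hN D)
        (tr ((kFam (onFun (dE (P := PV d ℓ m K hd hL) cf ∘ₗ (LinearMap.id - RE (domT hN D hk) cf) ∘ₗ dsE cf))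
            (fun c => mulOp (hB hN D c)) (fun c => mulOp (zB hN D (one_le_of_eight_le hM8) (four_le_of_five_le hP5) c))
            (fun c => Ml hN hk (one_le_of_eight_le hM8) (four_le_of_five_le hP5) hMha c (band_le (d := d) (ℓ := ℓ) hb₀ hb₁) (hpl c) w cf)
            (fun c => Pl hN hk (one_le_of_eight_le hM8) (four_le_of_five_le hP5) hMha c (band_le (d := d) (ℓ := ℓ) hb₀ hb₁) (hpl c) w cf) c c' *
          Gl hN hk (one_le_of_eight_le hM8) (four_le_of_five_le hP5) hMha c' (band_le (d := d) (ℓ := ℓ) hb₀ hb₁) (hpl c') w cf) * mulOp (hB hN D c')))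
        (fun y y' => θ₀ * Real.exp (-(σ * (geomT D).dist y y'))))
      (_ : (Nbig : ℝ) ^ 2 * θ₀ * K261 N₀ (d + 1) ((ℓ : ℝ) + 1) 1 (α * σ) < 1)
      (ν μ : Fin (d + 1)),
      HasL2Majorant (g := geomT D) (blkV1 hN D) (DV ν cf * DV μ cf * onFun (GE (domT hN D hk) hcf hw))
        (fun y y' => (Nbig * CD) * K261 N₀ (d + 1) ((ℓ : ℝ) + 1) 1 (α * σ) *
          (1 - (Nbig : ℝ) ^ 2 * θ₀ * K261 N₀ (d + 1) ((ℓ : ℝ) + 1) 1 (α * σ))⁻¹ * Real.exp (-((1 - α) * σ * (geomT D).dist y y'))) := by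
  have ha₀ : (0 : ℝ) < b₀ / ((ℓ + 1 : ℕ) : ℝ) := by positivity
  obtain ⟨ρD, hρD, CD, hCD, hDDG⟩ := hDDG0_l2_cube d ℓ hd hL ha₀ (band_le (d := d) (ℓ := ℓ) hb₀ hb₁)
  refine ⟨ρD, hρD, CD, hCD, ?_⟩
  intro m K Mh k R P' hN D hk hk2 a hMha hM8 hR2 hP5 hℓ hpl cf hcf w hw hwb σ hσ hσρ α hα0 hα1 N₀ hN₀ hRM hθ Nbig hNbig hMout θ₀ hθ₀ h2134 h2134T
    hsmall ν μ
  -- ### the torus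
  have hMh1 : 1 ≤ Mh := one_le_of_eight_le hM8
  have hP4 : ∀ μ, 4 ≤ P' μ := four_le_of_five_le hP5
  have hP : ∀ μ, 1 ≤ P' μ := one_le_of_four_le hP4
  have hMh : 2 ≤ Mh := le_trans (by norm_num) hM8
  have hR : 2 * (ℓ + 1) ≤ R := le_trans (by nlinarith : 2 * (ℓ + 1) ≤ 2 * (ℓ + 1) ^ 2) hR2
  have hdnn : ∀ y y' : (geomT D).Site, 0 ≤ (geomT D).dist y y' := fun _ _ => Nat.cast_nonneg _
  obtain ⟨htri, hrefl, -⟩ := triangle_refl_nonneg_T D hMh1 hP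
  obtain ⟨_, h261, _, h263⟩ := lemma21_torus D hMh1 hP hN₀ hRM hσ.le hα0 hα1 hθ
  have hc : 0 ≤ K261 N₀ (d + 1) ((ℓ : ℝ) + 1) 1 (α * σ) := K261_nonneg (by positivity) zero_le_one
  -- ### abbreviations of the genuine family
  set Dg : Module.End ℝ (PBond (PV d ℓ m K hd hL) 0 → ℝ) :=
    onFun (dE (P := PV d ℓ m K hd hL) cf ∘ₗ (LinearMap.id - RE (domT hN D hk) cf) ∘ₗ dsE cf) with hDg
  set Gls : ↥(cubes D.toDomains) → Module.End ℝ (PBond (PV d ℓ m K hd hL) 0 → ℝ) :=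
    fun c => Gl hN hk hMh1 hP4 hMha c (band_le (d := d) (ℓ := ℓ) hb₀ hb₁) (hpl c) w cf with hGls
  set Mls : ↥(cubes D.toDomains) → Module.End ℝ (PBond (PV d ℓ m K hd hL) 0 → ℝ) :=
    fun c => Ml hN hk hMh1 hP4 hMha c (band_le (d := d) (ℓ := ℓ) hb₀ hb₁) (hpl c) w cf with hMls
  set Pls : ↥(cubes D.toDomains) → Module.End ℝ (PBond (PV d ℓ m K hd hL) 0 → ℝ) :=
    fun c => Pl hN hk hMh1 hP4 hMha c (band_le (d := d) (ℓ := ℓ) hb₀ hb₁) (hpl c) w cf with hPls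
  set hBs : ↥(cubes D.toDomains) → Module.End ℝ (PBond (PV d ℓ m K hd hL) 0 → ℝ) := fun c => mulOp (hB hN D c) with hhBs
  set zBs : ↥(cubes D.toDomains) → Module.End ℝ (PBond (PV d ℓ m K hd hL) 0 → ℝ) := fun c => mulOp (zB hN D hMh1 hP4 c) with hzBs
  set DD : Module.End ℝ (PBond (PV d ℓ m K hd hL) 0 → ℝ) := DV ν cf * DV μ cf with hDD
  -- ### (2.91) for the genuine family and the fixed point
  have h291 : onFun (deltaAE (domT hN D hk) cf w) * gZero Finset.univ hBs Gls = 1 - rOp Finset.univ Dg hBs zBs Gls Mls Pls := by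
    rw [deltaAE_split]
    exact eq291 Finset.univ _ _ hBs zBs Gls Mls Pls (sum_mulOp_hB_sq hN D hMh1 hP)
      (fun c _ => hagree_cube hN hk hMh1 hP4 hMha c (band_le (d := d) (ℓ := ℓ) hb₀ hb₁) hk2 hM8 hR2 (hpl c) w hcf
        (fun i hi _ => band_of_global hN hk hMh1 hP4 c (le_of_lt hb₀) hcf w hwb i hi))
      (fun c _ => hinvl_cube hN hk hMh1 hP4 hMha c (band_le (d := d) (ℓ := ℓ) hb₀ hb₁) ha₀ hM8 hR2 (hpl c) w hcf)
      (fun c _ => mulOp_zB_mul_hB hN D hMh hR hP4 c) (fun c _ => mulOp_hB_mul_zB hN D hMh hR hP4 c)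
  have hinv := onFun_GE_mul_deltaAE (domT hN D hk) hcf hw
  have hfix0 : onFun (GE (domT hN D hk) hcf hw) =
      gZero Finset.univ hBs Gls + onFun (GE (domT hN D hk) hcf hw) * rOp Finset.univ Dg hBs zBs Gls Mls Pls := fixedPoint_of_291 hinv h291
  have key : ∀ A G G0 R' : Module.End ℝ (PBond (PV d ℓ m K hd hL) 0 → ℝ), G = G0 + G * R' → A * G = A * G0 + A * G * R' :=
    fun A G G0 R' h => by
      calc A * G = A * (G0 + G * R') := by rw [← h]
        _ = A * G0 + A * G * R' := by rw [mul_add, mul_assoc]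
  have hfix : DD * onFun (GE (domT hN D hk) hcf hw) =
      DD * gZero Finset.univ hBs Gls + (DD * onFun (GE (domT hN D hk) hcf hw)) * rOp Finset.univ Dg hBs zBs Gls Mls Pls :=
    key DD _ _ _ hfix0
  have hG0 : DD * gZero Finset.univ hBs Gls = ∑ c ∈ (Finset.univ : Finset ↥(cubes D.toDomains)), DD * (hBs c * Gls c * hBs c) := by
    unfold gZero; rw [Finset.mul_sum]
  have hRsum : rOp Finset.univ Dg hBs zBs Gls Mls Pls =
      ∑ c ∈ (Finset.univ : Finset ↥(cubes D.toDomains)), ∑ c' ∈ (Finset.univ : Finset ↥(cubes D.toDomains)),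
        (kFam Dg hBs zBs Mls Pls c c' * Gls c') * hBs c' := by
    unfold rOp; rfl
  -- ### the per-cube `ℓ²` legs of `∇∇(h_□G_□h_□)`, weakened to the rate `σ` and the reach `□̃`
  have hlegs : ∀ c ∈ (Finset.univ : Finset ↥(cubes D.toDomains)), HasL2Majorant (g := geomT D) (blkV1 hN D) (DD * (hBs c * Gls c * hBs c))
      (fun y y' => ind (SbigT D hMh1 hP4 c) y * (CD * (fun _ : (geomT D).Site => (1 : ℝ)) y * Real.exp (-(2 * σ / 2 * (geomT D).dist y y')))) := by
    intro c _
    have h := hDDG m K hN D hk hMh1 hP4 hMha hM8 hR2 hP5 hℓ c (hpl c) w hcf ν μ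
    have e : DD * (hBs c * Gls c * hBs c) = DV ν cf * (DV μ cf * (mulOp (hB hN D c) * Gls c * mulOp (hB hN D c))) := by
      rw [hDD, mul_assoc]
    rw [e]
    refine hasL2Majorant_mono (g := geomT D) _ h fun y y' => ?_
    have h1 := ind_ST_le_ind_SbigT (D := D) hMh1 hP4 c y
    have h2 := ind_le_one (ST D hMh1 hP4 c) y'
    have h3 := ind_nonneg (ST D hMh1 hP4 c) y'
    have h4 := ind_nonneg (ST D hMh1 hP4 c) y
    have h5 : Real.exp (-(ρD * (geomT D).dist y y')) ≤ Real.exp (-(2 * σ / 2 * (geomT D).dist y y')) := by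
      rw [show 2 * σ / 2 = σ by ring]; exact exp_le_exp_of_rate hσρ (hdnn y y')
    have h6 := Real.exp_nonneg (-(ρD * (geomT D).dist y y'))
    have hA : ind (ST D hMh1 hP4 c) y * ind (ST D hMh1 hP4 c) y' ≤ ind (SbigT D hMh1 hP4 c) y * 1 :=
      mul_le_mul h1 h2 h3 (ind_nonneg _ _)
    have hB : CD * Real.exp (-(ρD * (geomT D).dist y y')) ≤ CD * Real.exp (-(2 * σ / 2 * (geomT D).dist y y')) :=
      mul_le_mul_of_nonneg_left h5 hCD
    calc ind (ST D hMh1 hP4 c) y * ind (ST D hMh1 hP4 c) y' * (CD * Real.exp (-(ρD * (geomT D).dist y y')))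
        ≤ ind (SbigT D hMh1 hP4 c) y * 1 * (CD * Real.exp (-(2 * σ / 2 * (geomT D).dist y y'))) :=
          mul_le_mul hA hB (mul_nonneg hCD h6) (mul_nonneg (ind_nonneg _ _) zero_le_one)
      _ = _ := by ring
  -- ### the `ℓ²` bound of every pair product, from the two displayed sup bounds (Schur)
  have h2134l2 : ∀ c ∈ (Finset.univ : Finset ↥(cubes D.toDomains)), ∀ c' ∈ (Finset.univ : Finset ↥(cubes D.toDomains)),
      HasL2Majorant (g := geomT D) (blkV1 hN D) ((kFam Dg hBs zBs Mls Pls c c' * Gls c') * hBs c')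
        (fun y y' => θ₀ * Real.exp (-(2 * σ / 2 * (geomT D).dist y y'))) := by
    intro c _ c' _
    rw [show 2 * σ / 2 = σ by ring]
    exact hasL2Majorant_exp_of_hasMajorant_pair (g := geomT D) (blkV1 hN D) θ₀ σ hθ₀ (symmT D) (h2134 c c') (h2134T c c')
      (fun x x' => tr_single_apply _ x x')
  -- ### gluing + chain
  have hsmall' : ((Nbig : ℝ) ^ 2 * θ₀) * K261 N₀ (d + 1) ((ℓ : ℝ) + 1) 1 (α * σ) < 1 := hsmall
  have hmain := prop26_2140_of_l2legsWith (g := geomT D) (blkV1 hN D) (K261 N₀ (d + 1) ((ℓ : ℝ) + 1) 1 (α * σ)) (2 * σ) α θ₀ CD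
    (fun _ => (1 : ℝ)) hc hCD (fun _ => zero_le_one) hθ₀ hα1 (by positivity) htri hrefl hdnn
    (by rw [show 2 * σ / 2 = σ by ring]; exact h261) (by rw [show 2 * σ / 2 = σ by ring]; exact h263)
    Finset.univ (fun c => SbigT D hMh1 hP4 c) Nbig (hNov_SbigT_of_QbigT D hMh1 hP4 hNbig) hsmall'
    (fun c => DD * (hBs c * Gls c * hBs c)) hlegs (hB hN D)
    (fun c _ x hx => blkV1_mem_SbigT_of_hB_ne_zero hN D hMh hR hP4 c hx)
    (fun c c' => kFam Dg hBs zBs Mls Pls c c' * Gls c') h2134l2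
    (fun c _ c' _ => outLoc_kFam_big hN D hMh hR hMh1 hP4 Dg Gls Mls Pls hMout c c') hG0 hRsum hfix
  refine hasL2Majorant_mono (g := geomT D) _ hmain fun y y' => le_of_eq ?_
  simp only [delta3, mul_one]
  ring_nf

end Skeleton

/-! ## §3  The census Σ-shape and the transposed entry -/

section Shapes

open Classical in
/-- **(2.140)₅ AT k LEVELS IN THE CENSUS Σ-SHAPE** (r03's slot hl4): under the hypotheses of `prop26_2140_grad2_kLevel_skeleton`, for `supp ζ ⊂ Δ(y)`, `|ζ| ≤ s`,
`supp J ⊂ Δ(y′)`: `Σ_x (ζ(x)·(∇_ν∇_μGJ)(x))² ≤ (A·e^{−(1−α)σd_T(y,y′)}·s)²·Σ_x J(x)²`, `A = (Nbig·C_D)·K261·(1 − Nbig²θ₀K261)⁻¹`.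
[cite: Balaban1984PropagatorsII, Prop. 2.6 (2.140) p.247] -/
theorem prop26_2140_grad2_kLevel_sigma {X : Type} [Fintype X] {g : B6.Geometry} (blk : X → g.Site)
    {T : Module.End ℝ (X → ℝ)} {A δ : ℝ}
    (h : HasL2Majorant blk T (fun y y' => A * Real.exp (-(δ * g.dist y y'))))
    (y y' : g.Site) (ζ J : X → ℝ) {s : ℝ} (hs : 0 ≤ s)
    (hζ : ∀ x, blk x ≠ y → ζ x = 0) (hζs : ∀ x, |ζ x| ≤ s) (hJ : ∀ x, blk x ≠ y' → J x = 0) :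
    ∑ x, (ζ x * T J x) ^ 2 ≤ (A * Real.exp (-(δ * g.dist y y')) * s) ^ 2 * ∑ x, J x ^ 2 :=
  sum_sq_cut_apply_le_of_hasL2Majorant blk h y y' ζ J hs hζ hζs hJ

/-- **THE TRANSPOSED ENTRY** (toward (2.140)₆ = (2.140)₅ᵀ, `G∇*∇* = (∇∇G)ᵀ` for the symmetric `G`): a block-`ℓ²` majorant `A·e^{−δd}` of `T` with a symmetric
distance is one of `tr T`. [cite: Balaban1984PropagatorsII, Prop. 2.6 (2.140) p.247] -/
theorem hasL2Majorant_tr_exp {X : Type} [Fintype X] [DecidableEq X] {g : B6.Geometry} [DecidableEq g.Site] (blk : X → g.Site)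
    {T : Module.End ℝ (X → ℝ)} {A δ : ℝ} (hA : 0 ≤ A) (hsymm : ∀ y y' : g.Site, g.dist y y' = g.dist y' y)
    (h : HasL2Majorant blk T (fun y y' => A * Real.exp (-(δ * g.dist y y')))) :
    HasL2Majorant blk (tr T) (fun y y' => A * Real.exp (-(δ * g.dist y y'))) := by
  have h' := hasL2Majorant_tr blk h (fun a b => mul_nonneg hA (Real.exp_nonneg _))
  refine hasL2Majorant_mono blk h' fun y y' => le_of_eq ?_
  simp only [hsymm y' y]

end Shapes

/-! ## §4  (2.140)₅ at k levels with ONLY the transposed (2.134) family displayed -/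

section OnlyTranspose

open Classical in
/-- **PROPOSITION 2.6, THE `L²` ENTRY `‖ζ∇_ν∇_μGJ‖` OF (2.140) AT k LEVELS FOR THE GENUINE `G` — ONLY THE TRANSPOSED (2.134) FAMILY DISPLAYED.**
`prop26_2140_grad2_kLevel_skeleton` with the direct (2.134) family fed by `…B6Ineq2134KFamKLevelExportV1.h2134_kFam_kLevel_unconditional` (no displayed
analytic input), the output localisation by p38's `…B6CubeMoutV1.outLoc_Ml_hB'`, the overlap number `Nbig = 3·9^{d+1}` by r03's `card_filter_mem_QbigT_le`,
and the final constant `(1 − Nbig²θK261)⁻¹ ≤ 2`: for the weight band there are `σ₁ > 0`, `C_D ≥ 0` such that for all `0 < σ ≤ σ₁`, `α ∈ [0,1]`, `N₀ ≥ 1`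
there is `M₂ > 0` with: on every admissible V1 torus (`k ≥ 2`, `M_h = Lᵃ ≥ 8`, `M₂ ≤ L·M_h`, `R ≥ 2L²`, `P′ ≥ 5`, `L ≥ 5`, cubes placed, Lemma-2.1 budget,
global band), GIVEN the sup majorant `θ₁e^{−σd_T}` of every TRANSPOSED pair product `tr (K_{□,□′}G_{□′}h_{□′})` with `Nbig²θ₁·(2K261) < 1`:
`HasL2Majorant (∇_ν∇_μG) (2·(Nbig·C_D)·K261·e^{−(1−α)σ d_T})`. [cite: Balaban1984PropagatorsII, Prop. 2.6 (2.140)–(2.141) p.247, (2.134)–(2.135) p.247, (2.91) p.239, Lemma 2.1 p.234] -/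
theorem prop26_2140_grad2_kLevel_of_2134T (d ℓ : ℕ) (hd : 1 ≤ d + 1) (hL : Odd (ℓ + 1) ∧ 1 < ℓ + 1) {b₀ b₁ : ℝ} (hb₀ : 0 < b₀) (hb₁ : b₀ ≤ b₁) :
    ∃ σ₁ : ℝ, 0 < σ₁ ∧ ∃ CD : ℝ, 0 ≤ CD ∧ ∀ (σ : ℝ), 0 < σ → σ ≤ σ₁ → ∀ (α : ℝ), 0 ≤ α → α ≤ 1 → ∀ (N₀ : ℕ), 0 < N₀ →
    ∃ M₂ : ℝ, 0 < M₂ ∧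
    ∀ (m K : ℕ) {Mh k R : ℕ} {P' : Fin (d + 1) → ℕ}
      (hN : ∀ μ, N0 ℓ Mh k P' μ = (PV d ℓ m K hd hL).sitesPerDir 0) (D : TDomains d ℓ Mh k P' R) (hk : k ≤ m + K) (_ : 2 ≤ k)
      {a : ℕ} (hMha : Mh = (ℓ + 1) ^ a) (hM8 : 8 ≤ Mh) (_ : 2 * (ℓ + 1) ^ 2 ≤ R) (hP5 : ∀ μ, 5 ≤ P' μ) (_ : 4 ≤ ℓ)
      (hpl : ∀ c : ↥(cubes D.toDomains), Placed ℓ k P' c.1)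
      (_ : M₂ ≤ ((ℓ : ℝ) + 1) * Mh) (_ : N₀ + 1 ≤ R * ((ℓ + 1) * Mh))
      (_ : Real.exp (-(α * σ)) * ((ℓ : ℝ) + 1) ^ ((2 * (d + 1 : ℕ) : ℝ) / N₀) < 1)
      {cf : ℝ} (hcf : cf ≠ 0) {w : BondIdx (domT hN D hk) → ℝ} (hw : ∀ i, 0 < w i) (_ : GlobalBand b₀ b₁ cf w)
      -- the displayed TRANSPOSED (2.134) family, rate `σ`, with its located smallness
      (θ₁ : ℝ) (_ : 0 ≤ θ₁)
      (_ : ∀ c c' : ↥(cubes D.toDomains), HasMajorant (g := geomT D) (blkV1 hN D)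
        (tr ((kFam (onFun (dE (P := PV d ℓ m K hd hL) cf ∘ₗ (LinearMap.id - RE (domT hN D hk) cf) ∘ₗ dsE cf))
            (fun c => mulOp (hB hN D c)) (fun c => mulOp (zB hN D (one_le_of_eight_le hM8) (four_le_of_five_le hP5) c))
            (fun c => Ml hN hk (one_le_of_eight_le hM8) (four_le_of_five_le hP5) hMha c (band_le (d := d) (ℓ := ℓ) hb₀ hb₁) (hpl c) w cf)
            (fun c => Pl hN hk (one_le_of_eight_le hM8) (four_le_of_five_le hP5) hMha c (band_le (d := d) (ℓ := ℓ) hb₀ hb₁) (hpl c) w cf) c c' *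
          Gl hN hk (one_le_of_eight_le hM8) (four_le_of_five_le hP5) hMha c' (band_le (d := d) (ℓ := ℓ) hb₀ hb₁) (hpl c') w cf) * mulOp (hB hN D c')))
        (fun y y' => θ₁ * Real.exp (-(σ * (geomT D).dist y y'))))
      (_ : ((3 * 9 ^ (d + 1) : ℕ) : ℝ) ^ 2 * θ₁ * (2 * K261 N₀ (d + 1) ((ℓ : ℝ) + 1) 1 (α * σ)) < 1)
      (ν μ : Fin (d + 1)),
      HasL2Majorant (g := geomT D) (blkV1 hN D) (DV ν cf * DV μ cf * onFun (GE (domT hN D hk) hcf hw))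
        (fun y y' => 2 * (((3 * 9 ^ (d + 1) : ℕ) : ℝ) * CD) * K261 N₀ (d + 1) ((ℓ : ℝ) + 1) 1 (α * σ) *
          Real.exp (-((1 - α) * σ * (geomT D).dist y y'))) := by
  obtain ⟨ρD, hρD, CD, hCD, hsk⟩ := prop26_2140_grad2_kLevel_skeleton d ℓ hd hL hb₀ hb₁
  obtain ⟨σ₀, hσ₀, hJ⟩ := h2134_kFam_kLevel_unconditional d ℓ hd hL hb₀ hb₁
  refine ⟨min ρD σ₀, lt_min hρD hσ₀, CD, hCD, fun σ hσ hσ1 α hα0 hα1 N₀ hN₀ => ?_⟩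
  obtain ⟨M₂, hM₂, hJ2⟩ := hJ σ hσ (hσ1.trans (min_le_right _ _)) α hα0 N₀ hN₀ (3 * 9 ^ (d + 1))
  refine ⟨M₂, hM₂, ?_⟩
  intro m K Mh k R P' hN D hk hk2 a hMha hM8 hR2 hP5 hℓ hpl hM hRM hθ cf hcf w hw hwb θ₁ hθ₁ h2134T hsmallT ν μ
  have hMh1 : 1 ≤ Mh := one_le_of_eight_le hM8
  have hP4 : ∀ μ, 4 ≤ P' μ := four_le_of_five_le hP5
  have hMh : 2 ≤ Mh := le_trans (by norm_num) hM8
  obtain ⟨θ₀, hθ₀, hsm0, hfam⟩ := hJ2 m K hN D hk hk2 hMha hM8 hR2 hP5 hℓ hpl hM hcf w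
  have hK0 : 0 ≤ K261 N₀ (d + 1) ((ℓ : ℝ) + 1) 1 (α * σ) := K261_nonneg (by positivity) zero_le_one
  have hNb : (0 : ℝ) ≤ ((3 * 9 ^ (d + 1) : ℕ) : ℝ) := Nat.cast_nonneg _
  -- the common `θ = max θ₀ θ₁` and its smallness
  have hθ0 : 0 ≤ max θ₀ θ₁ := le_max_of_le_left hθ₀
  have hsm2 : ((3 * 9 ^ (d + 1) : ℕ) : ℝ) ^ 2 * max θ₀ θ₁ * (2 * K261 N₀ (d + 1) ((ℓ : ℝ) + 1) 1 (α * σ)) < 1 := by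
    rcases le_total θ₀ θ₁ with h01 | h10
    · rw [max_eq_right h01]; exact hsmallT
    · rw [max_eq_left h10]; exact hsm0
  have hsm : ((3 * 9 ^ (d + 1) : ℕ) : ℝ) ^ 2 * max θ₀ θ₁ * K261 N₀ (d + 1) ((ℓ : ℝ) + 1) 1 (α * σ) < 1 := small_of_small_two hθ0 hsm2
  have hdnn : ∀ y y' : (geomT D).Site, 0 ≤ (geomT D).dist y y' := fun _ _ => Nat.cast_nonneg _
  have hmain := hsk m K hN D hk hk2 hMha hM8 hR2 hP5 hℓ hpl hcf hw hwb hσ (hσ1.trans (min_le_left _ _)) α hα0 hα1 N₀ hN₀ hRM hθ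
    (3 * 9 ^ (d + 1)) (fun y => card_filter_mem_QbigT_le D hL hMh hR2 hMh1 hP4 y)
    (fun c => outLoc_Ml_hB' hN hk hMh1 hP4 hMha c (band_le (d := d) (ℓ := ℓ) hb₀ hb₁) hM8 hR2 hP5 (hpl c) w cf)
    (max θ₀ θ₁) hθ0
    (fun c c' => hasMajorant_mono (g := geomT D) _ (hfam c c') fun y y' =>
      mul_le_mul_of_nonneg_right (le_max_left _ _) (Real.exp_nonneg _))
    (fun c c' => hasMajorant_mono (g := geomT D) _ (h2134T c c') fun y y' =>
      mul_le_mul_of_nonneg_right (le_max_right _ _) (Real.exp_nonneg _))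
    hsm ν μ
  refine hasL2Majorant_mono (g := geomT D) _ hmain fun y y' => ?_
  have h := final_const_le (P := (1 : ℝ)) (E := Real.exp (-((1 - α) * σ * (geomT D).dist y y'))) hNb hCD hK0 hθ0 zero_le_one
    (Real.exp_nonneg _) hsm2
  simpa only [mul_one] using h

end OnlyTranspose

end Literature.MathematicalPhysics.QuantumFieldTheory.Balaban1983to89.B6RandomWalkL2Prop26Grad2KLevelV1
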